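import Mathlib
import Literature.MathematicalPhysics.QuantumFieldTheory.Dimock2011to13.SmallFieldBounds
import Literature.MathematicalPhysics.QuantumFieldTheory.Dimock2011to13.FreeFlowSingleStep
import Literature.MathematicalPhysics.QuantumFieldTheory.King1986.EffectiveLaplacianRate

/-!
# Dimock, *The renormalization group according to Balaban* I §2.1 / II §2.1: `Q_k = Q^k` — the composition of block
# averages IS the block average over the large cubes — and the constants `a_{k+1} = a_ka/(a_k + aL^{−2})`,
# `a_k = a(1 − L^{−2})/(1 − L^{−2k})`, PROVED on the tree's `ℤ^d` block geometry and from the tree's closed form `aK`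

**Citation header (reproduction of PUBLISHED work; template of the Bałaban lattice Yang–Mills cell).**
J. Dimock, *The renormalization group according to Balaban. I. Small fields*, Rev. Math. Phys. **25** (2013)
1330010 (= arXiv:1108.1335v2) [Dimock2013], §2.1 "block averaging": the composed averaging operator TeX L439–443,
LEMMA `\label{second}` L447–465 (its constant `a_k` L462–464) and the identity (ak) L515–518 in its proof (TeX source
held by the cell, `inputs/files/dimock/src/1108.1335/1108.1335.tex`, 7382e6540dded9be, 4263 lines).  J. Dimock, *The
renormalization group according to Balaban. II. Large fields*, J. Math. Phys. **54** (2013) 092301 (= arXiv:1212.5562v2)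
[Dimock2013BalabanII], §2.1 L465–467 and L474 (TeX `inputs/files/dimock/src/1212.5562/1212.5562.tex`, 75c5792fc48eacbc).
C. King, *The U(1) Higgs model. I. The continuum limit*, Commun. Math. Phys. **102** (1986) 649–677 [King1986], (2.13)
p. 653 for the same
constants (the tree's `King1986.aK`).  Dimock's papers are published and refereed and are the cell's TEMPLATE, not
manuscripts under audit; no quantity of the Bałaban series is touched.

**What the papers print (verbatim).**  I L439–443: *"The various averaging operators can be composed into a single
averaging operation over large cubes. Let Q_k = Q^k be averaging operator over cubes B_k(y) with L^{3k} sites (L^k on a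
side). The operator Q_k maps functions on 𝕋^{−k} to functions on 𝕋⁰: (Q_kf)(y) = L^{−3k} Σ_{x∈B_k(y)} f(x) = ∫_{|x−y|<1/2} f(x)
dx"*.  I LEMMA `second` (L447–465): *"ρ_k(Φ_k) can be written ρ_k(Φ_k) = 𝒩^{−1}_{a_k,𝕋⁰_{M+N−k}} ∫ exp(−(a_k/2)‖Φ_k − Q_kφ‖²)
ρ_0(φ_{L^k}) d^{(k)}φ where φ : 𝕋^{−k}_{M+N−k} → ℝ, dφ^{(k)} = L^{−k|𝕋^{−k}_{M+N−k}|/2} dφ and a_k = a(1 − L^{−2})/(1 − L^{−2k})"*.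
I L515–518: *"Here we use the identity a_{k+1} = a_ka/(a_k + aL^{−2})  (ak)"*.  II L465–467: *"We can also compose the
various averaging operators. For any field on any lattice define Q_jΦ = Q^jΦ. This is averaging over cubes with L^j
sites on a side."*  II L474: *"𝐚 = 𝐚^{(k)} = (a^{(k)}_1, …, a^{(k)}_k)  a^{(k)}_j = a_jL^{2(k−j)}"*.

**What is reproduced here (kernel-checked, zero `sorry`).**  On the `ℤ^d` block geometry of the tree
(`Balaban1983to89.B6QGQLower276`: `X d = Fin d → ℤ`, `side n = n + 1`, `blk`, `B n y`, `U n S`) with the block average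
`SmallFieldBounds.qavg n` (side `n + 1`):
* §1 **`Q_{(m+1)(n+1)} = Q_{m+1} ∘ Q_{n+1}`**: `blk_blk` (`blk m (blk n p) = blk (mn + m + n) p`, i.e. `⌊⌊p/(n+1)⌋/(m+1)⌋ =
  ⌊p/((m+1)(n+1))⌋`), `B_comp` (the cube of side `(m+1)(n+1)` at `u` is the union of the cubes of side `n+1` labelled by
  the cube of side `m+1` at `u`: `B (mn+m+n) u = U n (B m u)`), **`qavg_comp`** (`qavg m (qavg n f) = qavg (mn+m+n) f`);
* §2 **`Q^k = Q_k`** (*"Q_k = Q^k … cubes with L^k on a side"*): `qavg_zero` (side `1`: `Q_0 = id`), `predPow m k = (m+1)^k − 1`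
  with `predPow_succ`, and **`qavg_iterate`**: `(qavg m)^[k] = qavg (predPow m k)` — `k` averaging steps of side `L = m + 1`
  are ONE averaging step of side `L^k`, for every `d`, `L ≥ 1`, `k ≥ 0`;
* §3 **THE CONSTANTS**: with the tree's closed form `King1986.aK a L k = a(1 − L⁻²)/(1 − L^{−2k})` (= I L462–464 verbatim),
  **`aK_succ`** = (ak): `a_{k+1} = a_ka/(a_k + aL^{−2})` for `a > 0`, `L > 1`, `k ≥ 1` (from the tree's composition identity
  `King1986.inv_aK_add` `a_{k+n}⁻¹ = a_k⁻¹ + L^{−2k}a_n⁻¹` at `(1, k)` and `aK_one`), and the link to the one-step algebra of this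
  lineage: **`aNext_aK`**: `FreeFlowSingleStep.aNext (aK a L k) (a/L²) = aK a L (k+1)/L²` (*"a_{k+1}L^{−2}"*, the weight that
  `FreeFlowSingleStep`/`LocalizedSingleStep` write as `aNext a_k aL`); `aLayer` (II L474 `a^{(k)}_j = a_jL^{2(k−j)}`) with
  `aLayer_top`, `aLayer_succ`.

**Readings (declared).**  (i) Lattices are kept in integer coordinates: the fine lattice `𝕋^{−k}` and the unit lattice are
both `ℤ^d`, a block of side `n + 1` fine sites being labelled by a point of `ℤ^d`; the print's normalisation `L^{−3k}` is
`((n+1)^d)⁻¹` (`d = 3`, `n + 1 = L^k`).  Scale invariance *"Qφ_L = (Qφ)_L"* (I L411) is, in these coordinates, the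
identity map and is not a separate statement.  (ii) Infinite `ℤ^d` instead of the torus: block averaging is local, the
torus statement is the same computation on representatives.  (iii) `a_0`: the printed formula is `0/0` at `k = 0`
(`aK a L 0 = 0` in Lean); (ak) is stated for `k ≥ 1` with `a_1 = a` (`King1986.aK_one`).

**What is NOT claimed.**  LEMMA `second` itself and II LEMMA 2.1 (mabel) — the Gaussian convolution
`∫ exp(−(a/2L²)‖Φ_{k+1} − QΦ_k‖² − (a_k/2)‖Φ_k − Q_kφ‖²) dΦ_k = const·exp(−(a_{k+1}/2L²)‖Φ_{k+1} − Q_{k+1}φ‖²)` (its algebraic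
core (kingmaker0)–(fifty) is this lineage's `FreeFlowSingleStep` (cherry0)/(psik)/(stringy2); the integral is not
formalised); anything of B1–B16 (TEMPLATE.md §4.1 row «D1 §2.1» ↔ B5 §A–§B (1.5)–(1.15), B7 §B–C, B12 (0.13)–(0.20): the
gauge-covariant averages compose differently — grade T for B5 only).  NOT summit progress; NOT a statement about any
Bałaban paper; NOT continuum; NOT Clay.  Unit `b2b-balaban-template` gen 30 (journal CLAIM
D1D2-BLOCK-AVERAGING-COMPOSITION-KERNEL).

**Version.**  v1.0.1 — DOCFIX fold (docstring-only; declarations, statements and proofs byte-identical to v1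
p202333) of the outside cross-read b2b-balaban-beta-lit1-g28 (journal XREAD VERDICT l.3012 on request l.2999: ok CONSISTENT
5∕5, DOCFIX 1 LOW, INFO 3; certificate `HOME/b2b-balaban-beta-lit1/gen28/xread/XREAD-BlockAveragingComposition-v1.md`):
D1 — the citation header named King's companion paper («II, CMP 103 (1986) 323–349») for the bib key `King1986`, which is
*I. The continuum limit*, CMP **102** (1986) 649–677 (doi:10.1007/bf01221651), where (2.13) p. 653 lies; corrected.  v1 —
p202333 (2026-08-20, commit a2e7774b91ba).
-/

noncomputable section

open Finset
open Literature.MathematicalPhysics.QuantumFieldTheory.Balaban1983to89.B6QGQLower276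
open Literature.MathematicalPhysics.QuantumFieldTheory.Dimock2011to13.SmallFieldBounds (qavg qavg_def)
open Literature.MathematicalPhysics.QuantumFieldTheory.Dimock2011to13.FreeFlowSingleStep (aNext)
open Literature.MathematicalPhysics.QuantumFieldTheory.King1986 (aK aK_one aK_pos inv_aK_add)

namespace Literature.MathematicalPhysics.QuantumFieldTheory.Dimock2011to13.BlockAveragingComposition

variable {d : ℕ}

/-! ## §1 `Q_{(m+1)(n+1)} = Q_{m+1} ∘ Q_{n+1}` -/

/-- the product side: `side (mn + m + n) = side m · side n`, i.e. `(mn+m+n) + 1 = (m+1)(n+1)`. [folklore] -/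
private theorem side_comp (m n : ℕ) : side (m * n + m + n) = side m * side n := by
  unfold side; push_cast; ring

/-- **block labels compose**: `⌊⌊p/(n+1)⌋/(m+1)⌋ = ⌊p/((n+1)(m+1))⌋` componentwise — the cube of side `m+1` (of the
`(n+1)`-block lattice) containing the `(n+1)`-cube of `p` is the cube of side `(m+1)(n+1)` containing `p`.
[cite: Dimock2013, §2.1 L439–441 (arXiv:1108.1335v2 TeX); Dimock2013BalabanII, §2.1 L465–467 (arXiv:1212.5562v2 TeX)] -/
theorem blk_blk (m n : ℕ) (p : X d) : blk m (blk n p) = blk (m * n + m + n) p := by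
  funext ν
  show (p ν / side n) / side m = p ν / side (m * n + m + n)
  rw [side_comp, mul_comm (side m), Int.ediv_ediv_of_nonneg (side_facts n).1.le]

/-- **the large cube is the union of the small cubes it contains**: `B_{(m+1)(n+1)}(u) = ⋃_{y ∈ B_{m+1}(u)} B_{n+1}(y)`
(*"cubes B_k(y) with L^{3k} sites"*). [cite: Dimock2013, §2.1 L439–442 (arXiv:1108.1335v2 TeX); Dimock2013BalabanII, §2.1
L465–467 (arXiv:1212.5562v2 TeX)] -/
theorem B_comp (m n : ℕ) (u : X d) : B (m * n + m + n) u = U n (B m u) := by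
  ext p
  rw [mem_B, mem_U, mem_B, blk_blk]

/-- **`Q_{m+1} ∘ Q_{n+1} = Q_{(m+1)(n+1)}`**: averaging the `(n+1)`-block averages over blocks of side `m+1` is averaging over
blocks of side `(m+1)(n+1)` (*"The various averaging operators can be composed into a single averaging operation over
large cubes"*). [cite: Dimock2013, §2.1 L439–443 (arXiv:1108.1335v2 TeX); Dimock2013BalabanII, §2.1 L465–467
(arXiv:1212.5562v2 TeX)] -/
theorem qavg_comp (m n : ℕ) (f : X d → ℝ) (u : X d) : qavg m (qavg n f) u = qavg (m * n + m + n) f u := by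
  rw [qavg_def, qavg_def, B_comp, sum_U]
  simp only [qavg_def]
  rw [← Finset.mul_sum, ← mul_assoc, ← mul_inv, ← mul_pow]
  congr 3
  push_cast; ring

/-! ## §2 `Q^k = Q_k` -/

/-- side `1`: the block of `y` is `{y}`. [folklore] -/
private theorem B_zero (y : X d) : B 0 y = {y} := by
  ext p
  rw [mem_B, Finset.mem_singleton]
  constructor
  · intro h; rw [← h]; funext ν; simp [blk, side]
  · intro h; subst h; funext ν; simp [blk, side]

/-- `Q_0 = id` (blocks of side `L^0 = 1`). [cite: Dimock2013, §2.1 L439–442 (arXiv:1108.1335v2 TeX)] -/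
theorem qavg_zero (f : X d → ℝ) : qavg 0 f = f := by
  funext y
  rw [qavg_def, B_zero, Finset.sum_singleton]
  simp

/-- `(m+1)^k − 1`: the `n` with `side n = L^k` for `L = m + 1`. [cite: Dimock2013, §2.1 L439–441 (arXiv:1108.1335v2 TeX)] -/
def predPow (m k : ℕ) : ℕ := (m + 1) ^ k - 1

/-- `side (predPow m k) = L^k` with `L = m + 1`. [cite: Dimock2013, §2.1 L439–441 (arXiv:1108.1335v2 TeX)] -/
theorem side_predPow (m k : ℕ) : side (predPow m k) = ((m : ℤ) + 1) ^ k := by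
  unfold side predPow
  have h : 1 ≤ (m + 1) ^ k := Nat.one_le_pow _ _ (Nat.succ_pos m)
  push_cast [Nat.cast_sub h]
  ring

/-- one more factor of `L`: `predPow m (k+1) = m·predPow m k + m + predPow m k` (`L^{k+1} = L·L^k`).
[cite: Dimock2013, §2.1 L439–441 (arXiv:1108.1335v2 TeX)] -/
theorem predPow_succ (m k : ℕ) : predPow m (k + 1) = m * predPow m k + m + predPow m k := by
  unfold predPow
  have h : 1 ≤ (m + 1) ^ k := Nat.one_le_pow _ _ (Nat.succ_pos m)
  have h' : 1 ≤ (m + 1) ^ (k + 1) := Nat.one_le_pow _ _ (Nat.succ_pos m)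
  zify [h, h']
  rw [pow_succ]
  ring

/-- **`Q^k = Q_k`**: `k` block-averaging steps of side `L = m + 1` are one block-averaging step of side `L^k` (*"Let Q_k = Q^k
be averaging operator over cubes B_k(y) with L^{3k} sites (L^k on a side)"*; *"For any field on any lattice define Q_jΦ =
Q^jΦ. This is averaging over cubes with L^j sites on a side."*). [cite: Dimock2013, §2.1 L439–443 (arXiv:1108.1335v2 TeX);
Dimock2013BalabanII, §2.1 L465–467 (arXiv:1212.5562v2 TeX)] -/
theorem qavg_iterate (m k : ℕ) (f : X d → ℝ) : (qavg m)^[k] f = qavg (d := d) (predPow m k) f := by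
  induction k with
  | zero => simp [predPow, qavg_zero]
  | succ k ih =>
    rw [Function.iterate_succ_apply', ih]
    funext u
    rw [qavg_comp, predPow_succ]

/-- the printed instance `Q_{k+1} = QQ_k` (used throughout, e.g. (potpie) I L505, (cherry0) II L516): one more step of
side `L` after `Q_k`. [cite: Dimock2013, §2.1 L439–443 and (potpie) L503–506 (arXiv:1108.1335v2 TeX)] -/
theorem qavg_succ (m k : ℕ) (f : X d → ℝ) : qavg m (qavg (d := d) (predPow m k) f) = qavg (predPow m (k + 1)) f := by
  funext u
  rw [qavg_comp, predPow_succ]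

/-! ## §3 The constants `a_k` -/

/-- **(ak)**: `a_{k+1} = a_ka/(a_k + aL^{−2})` for the closed form `a_k = a(1 − L^{−2})/(1 − L^{−2k})` (= the tree's
`King1986.aK`; `a > 0`, `L > 1`, `k ≥ 1`) — from the composition identity `a_{1+k}⁻¹ = a_1⁻¹ + L^{−2}a_k⁻¹`
(`King1986.inv_aK_add`) and `a_1 = a`. [cite: Dimock2013, §2.1 Lemma second L462–464 and (ak) L515–518 (arXiv:1108.1335v2
TeX); King1986, (2.13) p.653] -/
theorem aK_succ {a L : ℝ} (ha : 0 < a) (hL : 1 < L) {k : ℕ} (hk : 1 ≤ k) :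
    aK a L (k + 1) = aK a L k * a / (aK a L k + a * (L ^ 2)⁻¹) := by
  have hak : 0 < aK a L k := aK_pos ha hL hk
  have hL2 : 0 < L ^ 2 := by positivity
  have h := inv_aK_add ha hL 1 k
  rw [aK_one hL, add_comm 1 k] at h
  have h' : aK a L (k + 1) = (a⁻¹ + (L ^ (2 * 1))⁻¹ * (aK a L k)⁻¹)⁻¹ := by rw [← h, inv_inv]
  rw [h']
  simp only [mul_one]
  field_simp

/-- **`a_{k+1}L^{−2} = aNext a_k (a/L²)`**: the next weight of this lineage's one-step algebra (`FreeFlowSingleStep.aNext a_k aL =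
a_kaL/(a_k + aL)`, `aL = a/L²`) at the closed-form `a_k` IS the closed-form `a_{k+1}` divided by `L²`.
[cite: Dimock2013, §2.1 (ak) L515–518 (arXiv:1108.1335v2 TeX); Dimock2013BalabanII, §2.1 (stringy2) L525–529
(arXiv:1212.5562v2 TeX)] -/
theorem aNext_aK {a L : ℝ} (ha : 0 < a) (hL : 1 < L) {k : ℕ} (hk : 1 ≤ k) :
    aNext (aK a L k) (a * (L ^ 2)⁻¹) = aK a L (k + 1) * (L ^ 2)⁻¹ := by
  have hak : 0 < aK a L k := aK_pos ha hL hk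
  have hL2 : 0 < L ^ 2 := by positivity
  rw [aK_succ ha hL hk, aNext]
  field_simp

/-- **the layer weights** `a^{(k)}_j = a_jL^{2(k−j)}` of the multiscale averaging (`j ≤ k`).
[cite: Dimock2013BalabanII, §2.1 L474 (arXiv:1212.5562v2 TeX)] -/
def aLayer (a L : ℝ) (k j : ℕ) : ℝ := aK a L j * L ^ (2 * (k - j))

/-- at the top layer `a^{(k)}_k = a_k`. [cite: Dimock2013BalabanII, §2.1 L474 (arXiv:1212.5562v2 TeX)] -/
theorem aLayer_top (a L : ℝ) (k : ℕ) : aLayer a L k k = aK a L k := by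
  simp [aLayer]

/-- one more level multiplies every lower layer weight by `L²`: `a^{(k+1)}_j = L²·a^{(k)}_j` for `j ≤ k` (the scaling of
the weights under one RG step). [cite: Dimock2013BalabanII, §2.1 L474 and L449–454 (arXiv:1212.5562v2 TeX)] -/
theorem aLayer_succ (a L : ℝ) {k j : ℕ} (hj : j ≤ k) : aLayer a L (k + 1) j = L ^ 2 * aLayer a L k j := by
  unfold aLayer
  rw [show 2 * (k + 1 - j) = 2 * (k - j) + 2 by omega, pow_add]
  ring

/-! ## §4 Instances -/

/-- `d = 1`, `L = 2`: two averaging steps of side `2` are one of side `4` (`predPow 1 2 = 3`). -/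
example (f : X 1 → ℝ) : qavg 1 (qavg 1 f) = qavg 3 f := by
  have h := qavg_iterate (d := 1) 1 2 f
  simpa [predPow, Function.iterate_succ, Function.iterate_zero] using h

/-- `a_2 = a·a/(a + a/L²) = aL²/(L² + 1)` for `L = 2`: `a_2 = 4a/5`. -/
example {a : ℝ} (ha : 0 < a) : aK a 2 2 = 4 * a / 5 := by
  have h := aK_succ ha (by norm_num : (1 : ℝ) < 2) (k := 1) le_rfl
  rw [aK_one (by norm_num : (1 : ℝ) < 2)] at h
  have h2 : aK a 2 2 = aK a 2 (1 + 1) := rfl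
  rw [h2, h]
  field_simp
  ring

end Literature.MathematicalPhysics.QuantumFieldTheory.Dimock2011to13.BlockAveragingComposition

end
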